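import Literature.MathematicalPhysics.QuantumFieldTheory.Balaban1983to89.B12Eq311RemainderQuadratic
import Literature.MathematicalPhysics.QuantumFieldTheory.Balaban1983to89.B12Lemma4CondIV

/-!
# `Balaban1983to89.B12CondIIIJConcrete` — T. Bałaban, *Renormalization group approach to lattice gauge field theories. I*,
Commun. Math. Phys. **109** (1987) 249–301 [Balaban1987RG1], §3 pp. 278–280: **the J-half («second inequality», |𝐉| < γ₀ = α₀) of
condition (iii) for the Lemma-4 configuration, DERIVED on the concrete current (1.8) by the printed route** (file 2 of 2 of p07 gen 8;
file 1 = `B12Eq311RemainderQuadratic`) — p. 279, verbatim: *«The second inequality in this condition is obtained in the same way. We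
start with (3.42) and we use again the formulas and the bounds (1.43)–(1.54) [14]. They give a bound of the type (3.44), but for the
second order operator ∂^{ξ*}∂^ξ. Then the same reasoning as between (3.44)–(3.47) gives the required second inequality in (iii).»*;
p. 280: *«This implies the first inequality in the condition (iii). The second is proved in the same way, as it was already discussed.»*

HONEST FRAMING (cell `lit-balaban`, verbatim): statement-level skeleton of published theorems with citation tags; proofs where landed; nothing here is a claim about the Yang–Mills mass gap.

PDF held: `paper:balaban1987-cmp109-rg-i-small-field` (journal page = PDF page + 248); pp. 278–281 re-read as images from the renders
`b2b-balaban-ref1/pages/1987-cmp109-rg-I-small-field/1987-cmp109-rg-I-small-field-p030…p033-x4.png` by this unit.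

UNTIL NOW.  `B12CondIIIJ` (the J-ladder of pp. 278–280 in schematic reals) takes as HYPOTHESES of stated shapes the inputs
(J1) «the J-linearisation remainder |𝐉(exp iξ𝐇) − ∂^{ξ*}∂^ξ𝐇| ≤ C·α₀²·x² at Q(…)», (J1′) «the same remainder at τQ(…) + B′ ≤ βL⁻²α₀» and the
five triangle inequalities `htri₁ … htri₅` of `B12CondIIIJ.jLadder_bound`; and Lemma 4 on the concrete spaces
(`B12Lemma4CondIV.ofBackground_mem_space'_lemma4_of_eq338`, p07 gen 6) carries ONE J-budget hypothesis `hJY` (gen-6 handoff «OPEN (f)»).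

WHAT THIS MODULE PROVES (theorems only; no `def`, no new `Prop`, no new fact; axioms standard).
§3 the J-LADDER INPUTS AS THEOREMS on the concrete current (1.8) (`B12Eq18Current.current π ξ`): (J1) `jRem_le` (N = ‖𝐅(1, 𝐇)(b)‖ ≤
   C_J·B²·α₀²·x², `C_J = (d−1)·Cπ·C_F(1)`, `B = B₃²O(1)M`, from the (3.37) sizes `|𝐇_j|, |∇^ξ𝐇_j| < Bα₀x` — file 1's
   `norm_rem311_one_le_sq`), (J1′) `jRem'_le` (N′ = ‖𝐅(1, 𝐊 + 𝐀₂)(b)‖ ≤ βL⁻²α₀ from the (3.37)/(3.50) sizes and ONE restriction of the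
   printed shape «(4B₃²O(1)M)²α₀ ≤ β» on our constant: `4·C_J·B²·α₀ ≤ β`), the five triangle inequalities (from file 1's `current_expI_eq`
   and the linearity of `∂^{ξ*}π∂^ξ`), and **`norm_current_lt_jBudget`**: for `𝐊 = 𝐇_j(□₀, τQ(…))`, `𝐀₂` of (3.50), `|B′| < α₃`:
   `‖J(exp iξ(𝐊 + 𝐀₂))(b)‖ <` the J-budget `(1+3β)α₀x³ + 3βα₀x² + B₃″α₃ + βL⁻²α₀` of `B12CondIIIJ`, from the PRINTED (3.42) at `Q(…)` +
   the (3.45)-analogues (J2)×2 + (J3) + the sizes — `B12CondIIIJ.jLadder_bound` BY NAME; **`norm_current_lt_alpha0`** (`< α₀`, by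
   `B12CondIIIJ.condIII_second_of_restrictions`).
§4 **`ofBackground_mem_space'_lemma4_of_jInputs`** — Lemma 4 (3.53), membership of the printed pair `(𝐔, J(𝐔))`,
   `𝐔 = exp iξ(𝐇_j(□₀, τQ(…)) + 𝐀₂)`, in `U^c_j(X, α₀, α₁)` = `B12Lemma4CondIV.ofBackground_mem_space'_lemma4_of_eq338` with its J-budget
   hypothesis `hJY` DISCHARGED (replaced by the printed (3.42) on the bonds of `Y` = □̃³, the (J2)×2 / (J3) inputs on `Y`, the
   (3.37)/(3.50) sizes on the lattice, `‖π‖ ≤ Cπ`, and the one restriction); `hL10_of_four_le` — the located extra restriction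
   `1 + 10β ≤ L²` (GAPS G-B12-03) follows from `4 ≤ L` (a fortiori from the print's standing «L odd > 11», (0.1) p. 251) and `β < 1`
   (it supplies the hypothesis `hL10` kept from gen 6).
SHAPE FINDING (for `B12CondIIIJ` §4 / GAPS G-adv2-28 (i)): along [14]'s route the remainder IS of the (J1) shape `C·α₀²·x²` — quadratic in
the COMMON bound `Bα₀x` of `|𝐇_j|` AND `|∇^ξ𝐇_j|` from (3.37), with no further power of `x` — so `B12CondIIIJ.no_x3_form` applies to it:
an x³-scale «bound of the type (3.44)» for `∂^{ξ*}∂^ξ𝐇_j` is not what this route delivers; `jineq344`'s x³ + βx² rung is (harmless: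
the J-half needs only `|𝐉| < α₀`, which closes at the x²-scale with margin, as in `B12CondIIIJ`).
HONEST SCOPE. (a) The sizes of `𝐇_j(Q)`, `𝐇_j(τQ)`, `𝐀₂` and of their plain gradients are assumed on ALL bonds / sites of the finite periodic
lattice where the print has them «on □̃³» (as in p07 gen 7; locality of `𝐅` is `B12Eq311Locality.rem311_congr`). (b) By reference, as
hypotheses in printed shapes: (3.42) itself (derivable from the (3.42) identity + (3.40) by `B12Ineq341Rotation.h42_of_eq342`), the
second-order parts (J2) of `𝐇_j = H_{1,j}B + …` ((174) [15]) under `∂^{ξ*}π∂^ξ`, the second-derivative bound (J3) on `𝐀₂`, and everything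
`B12Lemma4CondIV` takes by reference ((3.38)-data, (3.41) literal, (3.37), (3.45), (3.50)). (c) Constants ours (`C_F(1)` of gen 7).
(d) `[NormOneClass 𝔸]` (‖1‖ = 1) — true in the operator-norm models of `B12RegularSpaces111Unitary/SpecialUnitary`.
Unit `lit-balaban-p07` (Phase-2 seat p07 gen 8; TAKING line HOME/STATUS.md 2026-08-21T18:46:03Z; rows B12.Lem4 / B12.Eq3.36 /
B12.Eq3.37-3.47, owners r09/r20), HOME `run/shared/lean/pub/lit-balaban/`.
-/

noncomputable section

open NormedSpace Complex

namespace Literature.MathematicalPhysics.QuantumFieldTheory.Balaban1983to89.B12CondIIIJConcrete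

open Literature.MathematicalPhysics.QuantumFieldTheory.Balaban1983to89
open Literature.MathematicalPhysics.QuantumFieldTheory.Balaban1983to89.B9Eq39Adjoint (R)
open Literature.MathematicalPhysics.QuantumFieldTheory.Balaban1983to89.B12Eq311CurrentExpansion
open Literature.MathematicalPhysics.QuantumFieldTheory.Balaban1983to89.B12Eq311RemainderQuadratic
open Literature.MathematicalPhysics.QuantumFieldTheory.Balaban1983to89.B12RegularSpaces111
open Literature.MathematicalPhysics.QuantumFieldTheory.Balaban1983to89.B12Eq18Current

/-! ## §3  The J-ladder of pp. 278–280 with its inputs (J1), (J1′) and all triangle inequalities as THEOREMS -/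

section Ladder

/-- `0 ≤ C_F(ρ)` — the constant of (3.11)/(3.14) (gen 7's `C311`, a sum of products of exponentials and even powers).
[cite: Balaban1987RG1, (3.14) p.272] -/
theorem C311_nonneg (ρ : ℝ) : 0 ≤ C311 ρ := by
  unfold C311 KI KQ KR
  positivity

/-- The (J1′) arithmetic: with `u = Bα₀x ≤ Bα₀L⁻¹` ((3.37) size at `x ≤ L⁻¹`) and `2v ≤ βL⁻²α₀` (`v = B₃|B′| ≤ B₃α₃`, «2B₃α₃ ≤ βL⁻²α₀»
p. 280), `B ≥ 1`, `β ≤ 1`, `1 < L`: `(u + v)² ≤ 4B²α₀²L⁻²`. [cite: Balaban1987RG1, (3.51) p.280] -/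
theorem size_sq_le {B α₀ x L v β : ℝ} (hB : 1 ≤ B) (hα₀ : 0 ≤ α₀) (hx0 : 0 ≤ x) (hx : x ≤ L⁻¹) (hL : 1 < L)
    (hβ1 : β ≤ 1) (hv0 : 0 ≤ v) (hv : 2 * v ≤ β * L⁻¹ ^ 2 * α₀) :
    (B * α₀ * x + v) ^ 2 ≤ 4 * B ^ 2 * α₀ ^ 2 * L⁻¹ ^ 2 := by
  have hLpos : 0 < L := by linarith
  have hLinv0 : 0 < L⁻¹ := inv_pos.mpr hLpos
  have hLinv1 : L⁻¹ ≤ 1 := (inv_lt_one_of_one_lt₀ hL).le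
  have hB0 : 0 ≤ B := by linarith
  have hu : B * α₀ * x ≤ B * α₀ * L⁻¹ := mul_le_mul_of_nonneg_left hx (mul_nonneg hB0 hα₀)
  have hv' : v ≤ B * α₀ * L⁻¹ := by
    have h1 : β * L⁻¹ ^ 2 * α₀ ≤ 1 * L⁻¹ ^ 2 * α₀ :=
      mul_le_mul_of_nonneg_right (mul_le_mul_of_nonneg_right hβ1 (sq_nonneg _)) hα₀
    have h2 : L⁻¹ ^ 2 ≤ L⁻¹ := by nlinarith
    have h3 : 1 * L⁻¹ ^ 2 * α₀ ≤ L⁻¹ * α₀ := by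
      rw [one_mul]; exact mul_le_mul_of_nonneg_right h2 hα₀
    have h4 : L⁻¹ * α₀ ≤ 2 * (B * α₀ * L⁻¹) := by nlinarith [mul_nonneg hα₀ hLinv0.le]
    linarith
  have hsum : B * α₀ * x + v ≤ 2 * (B * α₀ * L⁻¹) := by linarith
  have hsum0 : 0 ≤ B * α₀ * x + v := add_nonneg (mul_nonneg (mul_nonneg hB0 hα₀) hx0) hv0
  calc (B * α₀ * x + v) ^ 2 ≤ (2 * (B * α₀ * L⁻¹)) ^ 2 := pow_le_pow_left₀ hsum0 hsum 2
    _ = 4 * B ^ 2 * α₀ ^ 2 * L⁻¹ ^ 2 := by ring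

variable {P : Params} {i : ℕ} {𝔸 : Type*} [NormedRing 𝔸] [NormedAlgebra ℂ 𝔸] [CompleteSpace 𝔸] [NormOneClass 𝔸]

/-- **(J1) as a theorem** — «They give a bound of the type (3.44), but for the second order operator ∂^{ξ*}∂^ξ»: for `𝐇` with the
(3.37) sizes `|𝐇|, |∇^ξ𝐇| ≤ Bα₀x` on the lattice (`B = B₃²O(1)M ≥ 1`, `(4B)²α₀ ≤ β ≤ 1`, `0 ≤ x ≤ L⁻¹`, `1 < L`), the J-linearisation
remainder of `B12CondIIIJ` is `N = ‖J(exp iξ𝐇)(b) − ∂^{ξ*}π∂^ξ𝐇(b)‖ = ‖𝐅(1, 𝐇)(b)‖ ≤ C_J·B²·α₀²·x²`, `C_J = (d − 1)·Cπ·C_F(1)` — the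
(J1) SHAPE `C·α₀²·x²` with `C = C_J·B²`. [cite: Balaban1987RG1, p.279 after (3.47)] -/
theorem jRem_le (c : B12Sec2to5.Lemma4Consts) (hR : B12Sec2to5.Lemma4Restrictions c) (hY : 1 ≤ c.B₃ ^ 2 * c.O₁ * c.M)
    {ξ Cπ x : ℝ} {π : 𝔸 →ₗ[ℂ] 𝔸} {H : PBond P i → 𝔸} (hξ : 0 < ξ) (hξ1 : ξ ≤ 1) (hx0 : 0 ≤ x) (hx : x ≤ c.L⁻¹)
    (hCπ : 0 ≤ Cπ) (hπn : ∀ X, ‖π X‖ ≤ Cπ * ‖X‖)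
    (hHg : ∀ b, ‖H b‖ ≤ c.B₃ ^ 2 * c.O₁ * c.M * c.α₀ * x)
    (hHd : ∀ μ ν y, ‖grad ξ μ (fun z => H ⟨z, ν⟩) y‖ ≤ c.B₃ ^ 2 * c.O₁ * c.M * c.α₀ * x) (b : PBond P i) :
    ‖rem311 π ξ (1 : PBond P i → 𝔸ˣ) H b‖
      ≤ (P.d - 1) * (Cπ * C311 1) * (c.B₃ ^ 2 * c.O₁ * c.M) ^ 2 * c.α₀ ^ 2 * x ^ 2 := by
  have hR' := hR
  unfold B12Sec2to5.Lemma4Restrictions at hR'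
  obtain ⟨hα₀, _, _, _, _, hββ₀, hβ₀, hL1, _, h10, _, _, _, _⟩ := hR'
  have hLinv1 : c.L⁻¹ ≤ 1 := (inv_lt_one_of_one_lt₀ hL1).le
  have hB0 : 0 ≤ c.B₃ ^ 2 * c.O₁ * c.M := by linarith
  have hs0 : 0 ≤ c.B₃ ^ 2 * c.O₁ * c.M * c.α₀ * x := mul_nonneg (mul_nonneg hB0 hα₀.le) hx0
  have hs1 : c.B₃ ^ 2 * c.O₁ * c.M * c.α₀ * x ≤ 1 := by
    have h1 : c.B₃ ^ 2 * c.O₁ * c.M * c.α₀ ≤ 1 := by nlinarith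
    calc c.B₃ ^ 2 * c.O₁ * c.M * c.α₀ * x ≤ 1 * 1 := mul_le_mul h1 (hx.trans hLinv1) hx0 zero_le_one
      _ = 1 := one_mul _
  calc ‖rem311 π ξ (1 : PBond P i → 𝔸ˣ) H b‖ ≤ (P.d - 1) * (Cπ * C311 1 * (c.B₃ ^ 2 * c.O₁ * c.M * c.α₀ * x) ^ 2) :=
        norm_rem311_one_le_sq hξ hξ1 hs0 hs1 hHg hHd hCπ hπn b
    _ = _ := by ring
set_option maxHeartbeats 400000 in
/-- **(J1′) as a theorem** — the same remainder «slightly modified for the present situation» (at `τQ(…) + B′`, cf. (3.51) → (3.52)):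
for `𝐊` with the (3.37) sizes and `𝐀₂` with `|𝐀₂|, |∇^ξ𝐀₂| ≤ B₃|B′|`, `|B′| < α₃` ((3.50)), under «all the restrictions» and the ONE
restriction of the printed shape «(4B₃²O(1)M)²α₀ ≤ β» on our constant, `4·C_J·B²·α₀ ≤ β`:
`N′ = ‖𝐅(1, 𝐊 + 𝐀₂)(b)‖ ≤ βL⁻²α₀`. [cite: Balaban1987RG1, (3.52) p.280] -/
theorem jRem'_le (c : B12Sec2to5.Lemma4Consts) (hR : B12Sec2to5.Lemma4Restrictions c) (hB : 1 ≤ c.B₃)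
    (hY : 1 ≤ c.B₃ ^ 2 * c.O₁ * c.M) {ξ Cπ x n : ℝ} {π : 𝔸 →ₗ[ℂ] 𝔸} {K A : PBond P i → 𝔸}
    (hresJ : 4 * ((P.d - 1) * (Cπ * C311 1)) * (c.B₃ ^ 2 * c.O₁ * c.M) ^ 2 * c.α₀ ≤ c.β)
    (hξ : 0 < ξ) (hξ1 : ξ ≤ 1) (hx0 : 0 ≤ x) (hx : x ≤ c.L⁻¹) (hn : n < c.α₃)
    (hCπ : 0 ≤ Cπ) (hπn : ∀ X, ‖π X‖ ≤ Cπ * ‖X‖)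
    (hKg : ∀ b, ‖K b‖ ≤ c.B₃ ^ 2 * c.O₁ * c.M * c.α₀ * x)
    (hKd : ∀ μ ν y, ‖grad ξ μ (fun z => K ⟨z, ν⟩) y‖ ≤ c.B₃ ^ 2 * c.O₁ * c.M * c.α₀ * x)
    (hAg : ∀ b, ‖A b‖ ≤ c.B₃ * n) (hAd : ∀ μ ν y, ‖grad ξ μ (fun z => A ⟨z, ν⟩) y‖ ≤ c.B₃ * n) (b : PBond P i) :
    ‖rem311 π ξ (1 : PBond P i → 𝔸ˣ) (K + A) b‖ ≤ c.β * c.L⁻¹ ^ 2 * c.α₀ := by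
  have hR' := hR
  unfold B12Sec2to5.Lemma4Restrictions at hR'
  obtain ⟨hα₀, _, _, _, _, hββ₀, hβ₀, hL1, _, h10, _, _, h13, _⟩ := hR'
  have hβ1 : c.β ≤ 1 := by linarith
  have hB0 : 0 ≤ c.B₃ ^ 2 * c.O₁ * c.M := by linarith
  have hv0 : 0 ≤ c.B₃ * n := (norm_nonneg _).trans (hAg b)
  have hv : 2 * (c.B₃ * n) ≤ c.β * c.L⁻¹ ^ 2 * c.α₀ := by
    have : c.B₃ * n ≤ c.B₃ * c.α₃ := mul_le_mul_of_nonneg_left hn.le (by linarith)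
    linarith
  have hsq := size_sq_le (B := c.B₃ ^ 2 * c.O₁ * c.M) hY hα₀.le hx0 hx hL1 hβ1 hv0 hv
  have hs0 : 0 ≤ c.B₃ ^ 2 * c.O₁ * c.M * c.α₀ * x + c.B₃ * n := add_nonneg (mul_nonneg (mul_nonneg hB0 hα₀.le) hx0) hv0
  have hCJ0 : 0 ≤ (P.d - 1) * (Cπ * C311 1) := by
    have hd : (1 : ℝ) ≤ P.d := by exact_mod_cast P.hd
    exact mul_nonneg (by linarith) (mul_nonneg hCπ (C311_nonneg 1))
  have hs1 : c.B₃ ^ 2 * c.O₁ * c.M * c.α₀ * x + c.B₃ * n ≤ 1 := by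
    -- (u + v)² ≤ 4B²α₀²L⁻² ≤ 1 (16B²α₀ ≤ β ≤ 1, L⁻¹ ≤ 1) and u + v ≥ 0
    have hLinv1 : c.L⁻¹ ≤ 1 := (inv_lt_one_of_one_lt₀ hL1).le
    have hLinv0 : 0 ≤ c.L⁻¹ := inv_nonneg.mpr (by linarith)
    have h1 : 4 * (c.B₃ ^ 2 * c.O₁ * c.M) ^ 2 * c.α₀ ^ 2 * c.L⁻¹ ^ 2 ≤ 1 := by
      have h2 : (c.B₃ ^ 2 * c.O₁ * c.M) ^ 2 * c.α₀ ≤ 1 / 16 := by nlinarith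
      have h3 : c.α₀ ≤ 1 := by nlinarith
      have h4 : c.L⁻¹ ^ 2 ≤ 1 := by nlinarith
      calc 4 * (c.B₃ ^ 2 * c.O₁ * c.M) ^ 2 * c.α₀ ^ 2 * c.L⁻¹ ^ 2
          = 4 * ((c.B₃ ^ 2 * c.O₁ * c.M) ^ 2 * c.α₀) * c.α₀ * c.L⁻¹ ^ 2 := by ring
        _ ≤ 4 * (1 / 16) * 1 * 1 := by
            refine mul_le_mul (mul_le_mul (mul_le_mul_of_nonneg_left h2 (by norm_num)) h3 hα₀.le (by norm_num)) h4
              (sq_nonneg _) (by norm_num)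
        _ ≤ 1 := by norm_num
    nlinarith
  calc ‖rem311 π ξ (1 : PBond P i → 𝔸ˣ) (K + A) b‖
      ≤ (P.d - 1) * (Cπ * C311 1 * (c.B₃ ^ 2 * c.O₁ * c.M * c.α₀ * x + c.B₃ * n) ^ 2) :=
        norm_rem311_one_le_sq hξ hξ1 hs0 hs1 (fun b' => (norm_add_le _ _).trans (add_le_add (hKg b') (hAg b')))
          (fun μ ν y => by
            show ‖grad ξ μ (fun z => K ⟨z, ν⟩ + A ⟨z, ν⟩) y‖ ≤ _
            rw [B12Lemma4Concrete.grad_add]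
            exact (norm_add_le _ _).trans (add_le_add (hKd μ ν y) (hAd μ ν y)))
          hCπ hπn b
    _ = (P.d - 1) * (Cπ * C311 1) * (c.B₃ ^ 2 * c.O₁ * c.M * c.α₀ * x + c.B₃ * n) ^ 2 := by ring
    _ ≤ (P.d - 1) * (Cπ * C311 1) * (4 * (c.B₃ ^ 2 * c.O₁ * c.M) ^ 2 * c.α₀ ^ 2 * c.L⁻¹ ^ 2) :=
        mul_le_mul_of_nonneg_left hsq hCJ0
    _ = 4 * ((P.d - 1) * (Cπ * C311 1)) * (c.B₃ ^ 2 * c.O₁ * c.M) ^ 2 * c.α₀ * (c.L⁻¹ ^ 2 * c.α₀) := by ring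
    _ ≤ c.β * (c.L⁻¹ ^ 2 * c.α₀) := mul_le_mul_of_nonneg_right hresJ (mul_nonneg (sq_nonneg _) hα₀.le)
    _ = c.β * c.L⁻¹ ^ 2 * c.α₀ := by ring

/-- **The J-half of (iii), on the concrete current (1.8), below the J-budget of `B12CondIIIJ`** — «We start with (3.42) and we use
again the formulas and the bounds (1.43)–(1.54) [14] … Then the same reasoning as between (3.44)–(3.47) gives the required second
inequality in (iii)» / p. 280 «The second is proved in the same way»: for `𝐇 = 𝐇_j(□₀, Q(…))`, `𝐊 = 𝐇_j(□₀, τQ(…))`, their common linear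
part `H₁ = H_{1,j}Q(…)` ((174) [15]), `𝐀₂` of (3.50) and `|B′| = n < α₃`, from the PRINTED (3.42) at the bond, the (3.45)-analogues (J2)
for `∂^{ξ*}π∂^ξ` at `Q` and at `τQ`, the second-derivative bound (J3) on `𝐀₂`, the (3.37)/(3.50) sizes on the lattice, «all the
restrictions» + `B ≥ 1`, `B₃ ≥ 1` and the one restriction `4·C_J·B²·α₀ ≤ β`:
`‖J(exp iξ(𝐊 + 𝐀₂))(b)‖ < (1+3β)α₀x³ + 3βα₀x² + B₃″α₃ + βL⁻²α₀` (`B12CondIIIJ.jLadder_bound` BY NAME, its (J1)/(J1′) and five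
triangle inequalities supplied by §§2–3). [cite: Balaban1987RG1, p.279 after (3.47)] -/
theorem norm_current_lt_jBudget (c : B12Sec2to5.Lemma4Consts) (hR : B12Sec2to5.Lemma4Restrictions c) (hB : 1 ≤ c.B₃)
    (hY : 1 ≤ c.B₃ ^ 2 * c.O₁ * c.M) {ξ Cπ x τ n B₃'' : ℝ} {π : 𝔸 →ₗ[ℂ] 𝔸} {H H₁ K A : PBond P i → 𝔸}
    (hresJ : 4 * ((P.d - 1) * (Cπ * C311 1)) * (c.B₃ ^ 2 * c.O₁ * c.M) ^ 2 * c.α₀ ≤ c.β)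
    (hξ : 0 < ξ) (hξ1 : ξ ≤ 1) (hx0 : 0 ≤ x) (hx : x ≤ c.L⁻¹) (hτ0 : 0 ≤ τ) (hτ1 : τ ≤ 1) (hn : n < c.α₃) (hB'' : 0 ≤ B₃'')
    (hCπ : 0 ≤ Cπ) (hπn : ∀ X, ‖π X‖ ≤ Cπ * ‖X‖)
    (hHg : ∀ b, ‖H b‖ ≤ c.B₃ ^ 2 * c.O₁ * c.M * c.α₀ * x)
    (hHd : ∀ μ ν y, ‖grad ξ μ (fun z => H ⟨z, ν⟩) y‖ ≤ c.B₃ ^ 2 * c.O₁ * c.M * c.α₀ * x)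
    (hKg : ∀ b, ‖K b‖ ≤ c.B₃ ^ 2 * c.O₁ * c.M * c.α₀ * x)
    (hKd : ∀ μ ν y, ‖grad ξ μ (fun z => K ⟨z, ν⟩) y‖ ≤ c.B₃ ^ 2 * c.O₁ * c.M * c.α₀ * x)
    (hAg : ∀ b, ‖A b‖ ≤ c.B₃ * n) (hAd : ∀ μ ν y, ‖grad ξ μ (fun z => A ⟨z, ν⟩) y‖ ≤ c.B₃ * n) (b : PBond P i)
    (h42 : ‖current π ξ (fun b => expI ξ (H b)) b‖ < (1 + 3 * c.β) * c.α₀ * x ^ 3)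
    (hS : ‖lapCur π ξ (1 : PBond P i → 𝔸ˣ) (H - H₁) b‖ < c.β * c.α₀ * x ^ 2)
    (hSτ : ‖lapCur π ξ (1 : PBond P i → 𝔸ˣ) (K - (τ : ℂ) • H₁) b‖ < c.β * c.α₀ * x ^ 2)
    (hA2 : ‖lapCur π ξ (1 : PBond P i → 𝔸ˣ) A b‖ ≤ B₃'' * n) :
    ‖current π ξ (fun b => expI ξ (K b + A b)) b‖
      < (1 + 3 * c.β) * c.α₀ * x ^ 3 + 3 * c.β * c.α₀ * x ^ 2 + B₃'' * c.α₃ + c.β * c.L⁻¹ ^ 2 * c.α₀ := by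
  have hR' := hR
  unfold B12Sec2to5.Lemma4Restrictions at hR'
  obtain ⟨hα₀, _, _, _, _, _, _, _, _, h10, _, _, _, _⟩ := hR'
  -- (J1) and its restriction
  have hN := jRem_le c hR hY hξ hξ1 hx0 hx hCπ hπn hHg hHd b
  have hCJ0 : 0 ≤ (P.d - 1) * (Cπ * C311 1) := by
    have hd : (1 : ℝ) ≤ P.d := by exact_mod_cast P.hd
    exact mul_nonneg (by linarith) (mul_nonneg hCπ (C311_nonneg 1))
  have hresN : (P.d - 1) * (Cπ * C311 1) * (c.B₃ ^ 2 * c.O₁ * c.M) ^ 2 * c.α₀ ≤ c.β := by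
    have h0 : 0 ≤ (P.d - 1) * (Cπ * C311 1) * (c.B₃ ^ 2 * c.O₁ * c.M) ^ 2 * c.α₀ :=
      mul_nonneg (mul_nonneg hCJ0 (sq_nonneg _)) hα₀.le
    linarith
  -- (J1′)
  have hN' := jRem'_le c hR hB hY hresJ hξ hξ1 hx0 hx hn hCπ hπn hKg hKd hAg hAd b
  -- the five triangle inequalities
  have e1 := current_expI_eq π ξ H b
  have htri₁ : ‖lapCur π ξ (1 : PBond P i → 𝔸ˣ) H b‖
      ≤ ‖current π ξ (fun b => expI ξ (H b)) b‖ + ‖rem311 π ξ (1 : PBond P i → 𝔸ˣ) H b‖ := by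
    rw [show lapCur π ξ (1 : PBond P i → 𝔸ˣ) H b
        = current π ξ (fun b => expI ξ (H b)) b - rem311 π ξ (1 : PBond P i → 𝔸ˣ) H b by rw [e1]; abel]
    exact norm_sub_le _ _
  have htri₂ : ‖lapCur π ξ (1 : PBond P i → 𝔸ˣ) H₁ b‖
      ≤ ‖lapCur π ξ (1 : PBond P i → 𝔸ˣ) H b‖ + ‖lapCur π ξ (1 : PBond P i → 𝔸ˣ) (H - H₁) b‖ := by
    rw [show lapCur π ξ (1 : PBond P i → 𝔸ˣ) H₁ b
        = lapCur π ξ (1 : PBond P i → 𝔸ˣ) H b - lapCur π ξ (1 : PBond P i → 𝔸ˣ) (H - H₁) b by rw [lapCur_sub]; abel]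
    exact norm_sub_le _ _
  have htri₃ : ‖lapCur π ξ (1 : PBond P i → 𝔸ˣ) K b‖
      ≤ τ * ‖lapCur π ξ (1 : PBond P i → 𝔸ˣ) H₁ b‖ + ‖lapCur π ξ (1 : PBond P i → 𝔸ˣ) (K - (τ : ℂ) • H₁) b‖ := by
    have e : lapCur π ξ (1 : PBond P i → 𝔸ˣ) K b
        = (τ : ℂ) • lapCur π ξ (1 : PBond P i → 𝔸ˣ) H₁ b + lapCur π ξ (1 : PBond P i → 𝔸ˣ) (K - (τ : ℂ) • H₁) b := by
      rw [lapCur_sub, lapCur_smul]; abel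
    rw [e]
    refine (norm_add_le _ _).trans (add_le_add (le_of_eq ?_) le_rfl)
    rw [norm_smul, Complex.norm_real, Real.norm_of_nonneg hτ0]
  have htri₄ : ‖lapCur π ξ (1 : PBond P i → 𝔸ˣ) (K + A) b‖
      ≤ ‖lapCur π ξ (1 : PBond P i → 𝔸ˣ) K b‖ + ‖lapCur π ξ (1 : PBond P i → 𝔸ˣ) A b‖ := by
    rw [lapCur_add]; exact norm_add_le _ _
  have e5 := current_expI_eq π ξ (K + A) b
  have htri₅ : ‖current π ξ (fun b => expI ξ (K b + A b)) b‖
      ≤ ‖lapCur π ξ (1 : PBond P i → 𝔸ˣ) (K + A) b‖ + ‖rem311 π ξ (1 : PBond P i → 𝔸ˣ) (K + A) b‖ := by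
    rw [show (fun b => expI ξ (K b + A b)) = (fun b => expI ξ ((K + A) b)) from rfl, e5]
    exact norm_add_le _ _
  exact B12CondIIIJ.jLadder_bound hα₀.le hB'' hresN hτ0 hτ1 hn h42 hN htri₁ hS htri₂ (norm_nonneg _) hSτ htri₃ hA2 htri₄
    hN' htri₅

/-- **The second inequality of (iii), |𝐉| < α₀ = γ₀, for the Lemma-4 configuration on the concrete current** — in the letters of the
step (`x = L^{j−1}η`, `1 ≤ j`, `L^jη ≤ 1`): the J-budget closes by `B12CondIIIJ.condIII_second_of_restrictions` under the unlisted
restriction «B₃″α₃ ≤ βL⁻²α₀» of (J3). [cite: Balaban1987RG1, p.280 after (3.52)] -/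
theorem norm_current_lt_alpha0 (c : B12Sec2to5.Lemma4Consts) (hR : B12Sec2to5.Lemma4Restrictions c) (hB : 1 ≤ c.B₃)
    (hY : 1 ≤ c.B₃ ^ 2 * c.O₁ * c.M) {ξ Cπ η τ n B₃'' : ℝ} {j : ℕ} {π : 𝔸 →ₗ[ℂ] 𝔸} {H H₁ K A : PBond P i → 𝔸}
    (hresJ : 4 * ((P.d - 1) * (Cπ * C311 1)) * (c.B₃ ^ 2 * c.O₁ * c.M) ^ 2 * c.α₀ ≤ c.β)
    (hres'' : B₃'' * c.α₃ ≤ c.β * c.L⁻¹ ^ 2 * c.α₀)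
    (hξ : 0 < ξ) (hξ1 : ξ ≤ 1) (hη : 0 ≤ η) (hj : 1 ≤ j) (hscale : c.L ^ j * η ≤ 1) (hτ0 : 0 ≤ τ) (hτ1 : τ ≤ 1)
    (hn : n < c.α₃) (hB'' : 0 ≤ B₃'') (hCπ : 0 ≤ Cπ) (hπn : ∀ X, ‖π X‖ ≤ Cπ * ‖X‖)
    (hHg : ∀ b, ‖H b‖ ≤ c.B₃ ^ 2 * c.O₁ * c.M * c.α₀ * (c.L ^ (j - 1) * η))
    (hHd : ∀ μ ν y, ‖grad ξ μ (fun z => H ⟨z, ν⟩) y‖ ≤ c.B₃ ^ 2 * c.O₁ * c.M * c.α₀ * (c.L ^ (j - 1) * η))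
    (hKg : ∀ b, ‖K b‖ ≤ c.B₃ ^ 2 * c.O₁ * c.M * c.α₀ * (c.L ^ (j - 1) * η))
    (hKd : ∀ μ ν y, ‖grad ξ μ (fun z => K ⟨z, ν⟩) y‖ ≤ c.B₃ ^ 2 * c.O₁ * c.M * c.α₀ * (c.L ^ (j - 1) * η))
    (hAg : ∀ b, ‖A b‖ ≤ c.B₃ * n) (hAd : ∀ μ ν y, ‖grad ξ μ (fun z => A ⟨z, ν⟩) y‖ ≤ c.B₃ * n) (b : PBond P i)
    (h42 : ‖current π ξ (fun b => expI ξ (H b)) b‖ < (1 + 3 * c.β) * c.α₀ * (c.L ^ (j - 1) * η) ^ 3)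
    (hS : ‖lapCur π ξ (1 : PBond P i → 𝔸ˣ) (H - H₁) b‖ < c.β * c.α₀ * (c.L ^ (j - 1) * η) ^ 2)
    (hSτ : ‖lapCur π ξ (1 : PBond P i → 𝔸ˣ) (K - (τ : ℂ) • H₁) b‖ < c.β * c.α₀ * (c.L ^ (j - 1) * η) ^ 2)
    (hA2 : ‖lapCur π ξ (1 : PBond P i → 𝔸ˣ) A b‖ ≤ B₃'' * n) :
    ‖current π ξ (fun b => expI ξ (K b + A b)) b‖ < c.α₀ := by
  have hR' := hR
  unfold B12Sec2to5.Lemma4Restrictions at hR'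
  obtain ⟨_, _, _, _, _, _, _, hL1, _, _, _, _, _, _⟩ := hR'
  have hLpos : 0 < c.L := by linarith
  exact B12CondIIIJ.condIII_second_of_restrictions c hR hη hj hscale hres''
    (norm_current_lt_jBudget c hR hB hY hresJ hξ hξ1 (B12CondIIIJ.scale_nonneg j hLpos hη)
      (B12CondIIIJ.scale_le hLpos hη hj hscale) hτ0 hτ1 hn hB'' hCπ hπn hHg hHd hKg hKd hAg hAd b h42 hS hSτ hA2)

end Ladder

/-! ## §4  Lemma 4 (3.53) on the concrete space with the J-budget hypothesis DISCHARGED -/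

section Lemma4

variable {P : Params} {i : ℕ} {𝔸 : Type*} [NormedRing 𝔸] [NormedAlgebra ℂ 𝔸] [CompleteSpace 𝔸] [NormOneClass 𝔸]
variable (𝓜 : Model 𝔸)

/-- The located extra restriction `1 + 10β ≤ L²` of `B12Eq338CondIV.margin352_of_restrictions` (GAPS G-B12-03) holds under «all the
restrictions» (`β ≤ β₀ < 1`) as soon as `4 ≤ L` — a fortiori under the print's standing «L_μ = L^m, L odd > 11» of (0.1).
[cite: Balaban1987RG1, (0.1) p.251] -/
theorem hL10_of_four_le (c : B12Sec2to5.Lemma4Consts) (hR : B12Sec2to5.Lemma4Restrictions c) (hL4 : 4 ≤ c.L) :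
    1 + 10 * c.β ≤ c.L ^ 2 := by
  unfold B12Sec2to5.Lemma4Restrictions at hR
  obtain ⟨_, _, _, _, _, hββ₀, hβ₀, _, _, _, _, _, _, _⟩ := hR
  nlinarith

/-- **Lemma 4, membership of the printed pair `(𝐔, J(𝐔))`, `𝐔 = exp iξ(𝐇_j(□₀, τQ(…)) + 𝐀₂)`, in `U^c_j(X, α₀, α₁)` — with condition
(iv) derived from the (3.38)-data (p07 gen 6) AND the J-half of (iii) DERIVED on the concrete current** —
`B12Lemma4CondIV.ofBackground_mem_space'_lemma4_of_eq338` with its J-budget hypothesis `hJY` replaced by: the PRINTED (3.42) at `Q(…)` on the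
bonds of `Y` (□̃³ ⊇ bonds of `X` and `X̃⁻²`), the (3.45)-analogues (J2) at `Q` and `τQ` and the second-derivative bound (J3) on `𝐀₂` on the
bonds of `Y`, the (3.37) sizes of `𝐇_j(Q)`, `𝐇_j(τQ)` and the (3.50) sizes of `𝐀₂` (with plain gradients) on the lattice, `‖πX‖ ≤ Cπ‖X‖`,
and ONE restriction of the printed shape «(4B₃²O(1)M)²α₀ ≤ β» on our constant, `4·C_J·B²·α₀ ≤ β` (`C_J = (d−1)·Cπ·C_F(1)`).
[cite: Balaban1987RG1, Lemma 4 (3.53) p.280 with p.279 after (3.47)] -/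
theorem ofBackground_mem_space'_lemma4_of_jInputs (c : B12Sec2to5.Lemma4Consts) (hR : B12Sec2to5.Lemma4Restrictions c)
    (hB : 1 ≤ c.B₃) (hY : 1 ≤ c.B₃ ^ 2 * c.O₁ * c.M) (hα₁ : 16 * (c.O₁ * c.M * c.α₁) ≤ c.β) (hL10 : 1 + 10 * c.β ≤ c.L ^ 2)
    {F : Frame P i 𝔸} {cs : StepConsts} (hξ : 0 < cs.ξ) (hξ1 : cs.ξ ≤ 1) (hcB : 0 < cs.cB)
    (hL : 1 ≤ cs.L) (hLξ : cs.L ^ cs.j * cs.ξ = 1)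
    {η τ n B₃'' Cπ : ℝ} {j : ℕ} (hη : 0 ≤ η) (hj : 1 ≤ j) (hscale : c.L ^ j * η ≤ 1)
    (hξx : cs.ξ * (c.L ^ (j - 1) * η) = c.L⁻¹ * η) (hτ0 : 0 ≤ τ) (hτ1 : τ ≤ 1) (hn : n < c.α₃) (hB'' : 0 ≤ B₃'')
    (hres'' : B₃'' * c.α₃ ≤ c.β * c.L⁻¹ ^ 2 * c.α₀)
    (hresJ : 4 * ((P.d - 1) * (Cπ * C311 1)) * (c.B₃ ^ 2 * c.O₁ * c.M) ^ 2 * c.α₀ ≤ c.β)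
    (heGc : ∀ A ∈ 𝓜.gc, expI cs.ξ A ∈ 𝓜.Gc) (π : 𝔸 →ₗ[ℂ] 𝔸) (hπ : ∀ X, π X ∈ 𝓜.gc)
    (hgc : ∀ g ∈ 𝓜.Gc, ∀ X ∈ 𝓜.gc, R g X ∈ 𝓜.gc) (hπR : ∀ (g : 𝔸ˣ) (X : 𝔸), π (R g X) = R g (π X))
    (hCπ : 0 ≤ Cπ) (hπn : ∀ X, ‖π X‖ ≤ Cπ * ‖X‖)
    {Y : Region P i} (hXb : F.X.bonds ⊆ Y.bonds) (hXd : F.X.dpairs ⊆ Y.dpairs) (hX₂b : F.X₂.bonds ⊆ Y.bonds)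
    (hX₂p : F.X₂.plaqs ⊆ F.X.plaqs)
    (hXp : ∀ p ∈ F.X.plaqs, (⟨p.src, p.μ⟩ : PBond P i) ∈ Y.bonds ∧ (⟨p.src.shift p.μ, p.ν⟩ : PBond P i) ∈ Y.bonds ∧
      (⟨p.src.shift p.ν, p.μ⟩ : PBond P i) ∈ Y.bonds ∧ (⟨p.src, p.ν⟩ : PBond P i) ∈ Y.bonds ∧
      (p.src, p.μ, p.ν) ∈ Y.dpairs ∧ (p.src, p.ν, p.μ) ∈ Y.dpairs)
    {H H₁ K A : PBond P i → 𝔸} {ℓ : Plaq P i → 𝔸} (hKgc : ∀ b, K b ∈ 𝓜.gc) (hAgc : ∀ b, A b ∈ 𝓜.gc)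
    (h41 : ∀ p ∈ F.X.plaqs, ‖((plaq (fun b => expI cs.ξ (H b)) p : 𝔸ˣ) : 𝔸) - 1‖ <
      Real.exp (c.B₃ ^ 2 * c.O₁ * c.M * c.α₀) * Real.exp (c.B₃ * c.O₁ * c.M * c.α₀) *
      Real.exp (c.B₃ * c.O₁ * c.M * c.α₀) * Real.exp (c.O₁ * c.M * c.α₁) *
      ((1 + 2 * c.β) * c.α₀ * (c.L⁻¹ * η) ^ 2))
    (hH : ∀ b, ‖H b‖ < c.B₃ ^ 2 * c.O₁ * c.M * c.α₀ * (c.L ^ (j - 1) * η))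
    (hHd : ∀ μ ν y, ‖grad cs.ξ μ (fun z => H ⟨z, ν⟩) y‖ < c.B₃ ^ 2 * c.O₁ * c.M * c.α₀ * (c.L ^ (j - 1) * η))
    (h45 : ∀ p ∈ F.X.plaqs, ‖(cs.ξ : ℂ)⁻¹ • (H ⟨p.src, p.μ⟩ + H ⟨p.src.shift p.μ, p.ν⟩ - H ⟨p.src.shift p.ν, p.μ⟩ -
      H ⟨p.src, p.ν⟩) - ℓ p‖ < c.B₃ * (c.B₃ * c.O₁ * c.M * c.α₀ * (c.L ^ (j - 1) * η)) ^ 2)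
    (hK : ∀ b, ‖K b‖ < c.B₃ ^ 2 * c.O₁ * c.M * c.α₀ * (c.L ^ (j - 1) * η))
    (hKd : ∀ μ ν y, ‖grad cs.ξ μ (fun z => K ⟨z, ν⟩) y‖ < c.B₃ ^ 2 * c.O₁ * c.M * c.α₀ * (c.L ^ (j - 1) * η))
    (h45τ : ∀ p ∈ F.X.plaqs, ‖(cs.ξ : ℂ)⁻¹ • (K ⟨p.src, p.μ⟩ + K ⟨p.src.shift p.μ, p.ν⟩ - K ⟨p.src.shift p.ν, p.μ⟩ -
      K ⟨p.src, p.ν⟩) - (τ : ℂ) • ℓ p‖ < c.B₃ * (c.B₃ * c.O₁ * c.M * c.α₀ * (c.L ^ (j - 1) * η)) ^ 2)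
    (hA : ∀ b, ‖A b‖ ≤ c.B₃ * n) (hAd : ∀ μ ν y, ‖grad cs.ξ μ (fun z => A ⟨z, ν⟩) y‖ ≤ c.B₃ * n)
    (h42 : ∀ b ∈ Y.bonds, ‖current π cs.ξ (fun b => expI cs.ξ (H b)) b‖ < (1 + 3 * c.β) * c.α₀ * (c.L ^ (j - 1) * η) ^ 3)
    (hS : ∀ b ∈ Y.bonds, ‖lapCur π cs.ξ (1 : PBond P i → 𝔸ˣ) (H - H₁) b‖ < c.β * c.α₀ * (c.L ^ (j - 1) * η) ^ 2)
    (hSτ : ∀ b ∈ Y.bonds,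
      ‖lapCur π cs.ξ (1 : PBond P i → 𝔸ˣ) (K - (τ : ℂ) • H₁) b‖ < c.β * c.α₀ * (c.L ^ (j - 1) * η) ^ 2)
    (hA2 : ∀ b ∈ Y.bonds, ‖lapCur π cs.ξ (1 : PBond P i → 𝔸ˣ) A b‖ ≤ B₃'' * n)
    {uj : Site P i → 𝔸ˣ} {ubar w₁ : ℕ → Site P i → 𝔸ˣ} {ctr : ℕ → Site P i → Site P i}
    (huj : ∀ y, ‖(uj y : 𝔸)‖ * ‖(↑(uj y)⁻¹ : 𝔸)‖ ≤ Real.exp (c.B₃ ^ 2 * c.O₁ * c.M * c.α₀))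
    (hubar : ∀ n x, ubar n x = uj (ctr n x))
    (h338 : ∀ m, 1 ≤ m → m ≤ cs.j → ∀ p ∈ F.X₂.plaqs, plaq (F.bg.Un m (fun b => expI cs.ξ (K b + A b))) p =
      plaq (gaugeU (uj * (ubar m)⁻¹) (fun b => expI cs.ξ (K b + A b))) p)
    (hJn : ∀ m, 1 ≤ m → m ≤ cs.j → ∀ b ∈ F.X₂.bonds, F.bg.Jn m (fun b => expI cs.ξ (K b + A b)) b =
      current π (cs.L ^ m)⁻¹ (gaugeU (uj * (ubar m)⁻¹) (fun b => expI cs.ξ (K b + A b))) b)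
    (h338₁ : ∀ m, 1 ≤ m → m ≤ cs.j → ∀ p ∈ F.X₂.plaqs,
      plaq (F.bg.Un m (1 : PBond P i → 𝔸ˣ)) p = plaq (gaugeU (w₁ m) (1 : PBond P i → 𝔸ˣ)) p)
    (hJn₁ : ∀ m, 1 ≤ m → m ≤ cs.j → ∀ b ∈ F.X₂.bonds,
      F.bg.Jn m (1 : PBond P i → 𝔸ˣ) b = current π (cs.L ^ m)⁻¹ (gaugeU (w₁ m) (1 : PBond P i → 𝔸ˣ)) b) :
    ofBackground π cs.ξ (fun b => expI cs.ξ (K b + A b)) ∈ space' 𝓜 F cs c.α₀ c.α₁ :=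
  B12Lemma4CondIV.ofBackground_mem_space'_lemma4_of_eq338 𝓜 c hR hB hY hα₁ hL10 hξ hξ1 hcB hL hLξ hη hj hscale hξx hτ0 hτ1 hn
    hres'' heGc π hπ hgc hπR hXb hXd hX₂b hX₂p hXp hKgc hAgc h41 (fun b _ => hH b) h45 (fun b _ => hK b)
    (fun q _ => hKd q.2.1 q.2.2 q.1) h45τ (fun b _ => hA b) (fun q _ => hAd q.2.1 q.2.2 q.1)
    (fun b hb => norm_current_lt_jBudget c hR hB hY hresJ hξ hξ1
      (B12CondIIIJ.scale_nonneg j (by unfold B12Sec2to5.Lemma4Restrictions at hR; linarith [hR.2.2.2.2.2.2.2.1]) hη)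
      (B12CondIIIJ.scale_le (by unfold B12Sec2to5.Lemma4Restrictions at hR; linarith [hR.2.2.2.2.2.2.2.1]) hη hj hscale)
      hτ0 hτ1 hn hB'' hCπ hπn (fun b => (hH b).le) (fun μ ν y => (hHd μ ν y).le) (fun b => (hK b).le)
      (fun μ ν y => (hKd μ ν y).le) hA hAd b (h42 b hb) (hS b hb) (hSτ b hb) (hA2 b hb))
    huj hubar h338 hJn h338₁ hJn₁

end Lemma4

end Literature.MathematicalPhysics.QuantumFieldTheory.Balaban1983to89.B12CondIIIJConcrete
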